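import Literature.Analysis.PDE.SobolevEnergy
import Literature.Analysis.FunctionSpaces.RegularizedDistance
import HarnessLib

/-!
# Leibniz bounds for the recursive Sobolev energies (topic `Analysis/PDE`)

Analytic layer of the programme to prove short-time existence for quasilinear strictly
parabolic systems on a closed manifold (hypothesis `hQL` of
`Literature.Geometry.Riemannian.ricciFlow_shortTime_existence_of_quasilinear`). The
freezing-of-coefficients parametrix on a closed manifold multiplies solutions of constant
coefficient heat equations by smooth scalar functions: cut-offs `χ`, and coefficient deviations
`a - a₀` which are SMALL in sup norm but not in `C^k`. The estimate that makes the Neumann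
series contract at every Sobolev order is the **refined Leibniz bound** for the recursive
energies `E_k` of `SobolevEnergy.lean`: the top order sees only `sup |a|`, all derivatives of
`a` are pushed to one order less of `g`:

* `sobolevEnergy_smul_le_zero` — `E_0(a • g) ≤ M₀² E_0(g)` if `|a| ≤ M₀`;
* `sobolevEnergy_smul_le_succ` — for every `k` there is a constant `C` (depending only on `k`
  and `dim E`) with `E_{k+1}(a • g) ≤ 2^{k+1} M₀² E_{k+1}(g) + C M² E_k(g)` whenever
  `|a| ≤ M₀` and all iterated directional derivatives of `a` along the standard frame of orders
  `1, …, k+1` are bounded by `M` (`a` and `g` smooth).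

(Adams, *Sobolev Spaces*, ¶3.1 / Evans, *PDE*, §5.2.3, Thm. 1 (iv): `W^{k,p}` is stable under
multiplication by smooth bounded functions, by the Leibniz formula; here in the quantitative
form with the sup norm isolated at top order.)

Everything is proved; no named fact and no `sorry` is introduced.

## References

* R. A. Adams, *Sobolev Spaces*, Academic Press 1975, ¶3.1. [Adams1975]
* L. C. Evans, *Partial Differential Equations*, 2nd ed., AMS 2010, §5.2.3, Thm. 1. [Evans2010]
-/

noncomputable section

open MeasureTheory Set Function Filter Topology
open scoped ENNReal ContDiff

namespace Literature.Analysis.PDE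

open Literature.Analysis.FunctionSpaces

variable {E : Type*} [NormedAddCommGroup E] [InnerProductSpace ℝ E] [FiniteDimensional ℝ E]
  [MeasurableSpace E] [BorelSpace E]
variable {F : Type*} [NormedAddCommGroup F] [NormedSpace ℝ F]

/-- Pointwise: `‖a • v‖ₑ² ≤ ofReal (M²) ‖v‖ₑ²` if `|a| ≤ M`. [folklore] -/
theorem enorm_smul_sq_le {a M : ℝ} (ha : |a| ≤ M) (v : F) :
    ‖a • v‖ₑ ^ 2 ≤ ENNReal.ofReal (M ^ 2) * ‖v‖ₑ ^ 2 := by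
  rw [enorm_smul, mul_pow]
  refine mul_le_mul' ?_ le_rfl
  have hM : 0 ≤ M := (abs_nonneg a).trans ha
  rw [Real.enorm_eq_ofReal_abs, ← ENNReal.ofReal_pow (abs_nonneg a)]
  exact ENNReal.ofReal_le_ofReal (pow_le_pow_left₀ (abs_nonneg a) ha 2)

/-- **Order zero**: `E_0(a • g) ≤ M₀² E_0(g)` if `|a| ≤ M₀`. [folklore] -/
theorem sobolevEnergy_smul_le_zero {a : E → ℝ} {M₀ : ℝ} (ha : ∀ x, |a x| ≤ M₀) (g : E → F) :
    sobolevEnergy 0 (fun x ↦ a x • g x) ≤ ENNReal.ofReal (M₀ ^ 2) * sobolevEnergy 0 g := by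
  simp only [sobolevEnergy_zero_left]
  rw [← lintegral_const_mul' _ _ (by simp)]
  exact lintegral_mono fun x ↦ enorm_smul_sq_le (ha x) (g x)

omit [FiniteDimensional ℝ E] [MeasurableSpace E] [BorelSpace E] in
/-- Directional derivative of a product of a smooth scalar and a smooth vector function.
[folklore] -/
theorem fderiv_smul_apply_eq {a : E → ℝ} {g : E → F} (ha : ContDiff ℝ ∞ a) (hg : ContDiff ℝ ∞ g)
    (x v : E) :
    fderiv ℝ (fun y ↦ a y • g y) x v = a x • fderiv ℝ g x v + (fderiv ℝ a x v) • g x := by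
  have hda : DifferentiableAt ℝ a x := (ha.differentiable (by simp)) x
  have hdg : DifferentiableAt ℝ g x := (hg.differentiable (by simp)) x
  rw [fderiv_fun_smul hda hdg]
  simp [ContinuousLinearMap.smulRight_apply]

/-- **The refined Leibniz bound at every order.** For every `k` there is `C < ∞` (depending only
on `k` and `dim E`) such that for smooth `a : E → ℝ`, `g : E → F` with `|a| ≤ M₀` and all
iterated directional derivatives of `a` along the standard frame of orders `1, …, k + 1` bounded
by `M`: `E_{k+1}(a • g) ≤ 2^{k+1} M₀² E_{k+1}(g) + C M² E_k(g)`.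
[cite: Evans2010, §5.2.3, Thm. 1] -/
theorem sobolevEnergy_smul_le_succ (k : ℕ) :
    ∃ C : ℝ≥0∞, C ≠ ⊤ ∧ ∀ {a : E → ℝ} {g : E → F}, ContDiff ℝ ∞ a → ContDiff ℝ ∞ g →
      ∀ {M₀ M : ℝ}, (∀ x, |a x| ≤ M₀) →
        (∀ l : List (Fin (Module.finrank ℝ E)), l ≠ [] → l.length ≤ k + 1 →
          ∀ x, ‖iterDirDeriv (l.map (stdOrthonormalBasis ℝ E)) a x‖ ≤ M) →
        sobolevEnergy (k + 1) (fun x ↦ a x • g x) ≤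
          2 ^ (k + 1) * ENNReal.ofReal (M₀ ^ 2) * sobolevEnergy (k + 1) g +
            C * ENNReal.ofReal (M ^ 2) * sobolevEnergy k g := by
  induction k with
  | zero =>
    -- `E_1(ag) = ∫|ag|² + Σᵢ E_0(a ∂ᵢg + ∂ᵢa g) ≤ M₀²E_0 g + Σᵢ (2M₀² E_0(∂ᵢg) + 2M² E_0 g)`
    refine ⟨2 * (Module.finrank ℝ E : ℝ≥0∞), ENNReal.mul_ne_top (by simp) (by simp), ?_⟩
    intro a g ha hg M₀ M h0 h1
    have hb : ∀ i x, |fderiv ℝ a x (stdOrthonormalBasis ℝ E i)| ≤ M := fun i x ↦ by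
      have h := h1 [i] (by simp) (by simp) x
      simpa [FunctionSpaces.iterDirDeriv, Real.norm_eq_abs] using h
    rw [sobolevEnergy_succ, sobolevEnergy_succ]
    simp only [sobolevEnergy_zero_left]
    have hmain : ∀ i, ∫⁻ x, ‖fderiv ℝ (fun y ↦ a y • g y) x (stdOrthonormalBasis ℝ E i)‖ₑ ^ 2 ≤
        2 * (ENNReal.ofReal (M₀ ^ 2) * ∫⁻ x, ‖fderiv ℝ g x (stdOrthonormalBasis ℝ E i)‖ₑ ^ 2) +
          2 * (ENNReal.ofReal (M ^ 2) * ∫⁻ x, ‖g x‖ₑ ^ 2) := fun i ↦ by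
      simp only [fderiv_smul_apply_eq ha hg]
      have hc : Continuous fun x ↦ a x • fderiv ℝ g x (stdOrthonormalBasis ℝ E i) :=
        ha.continuous.smul ((hg.continuous_fderiv (by simp)).clm_apply continuous_const)
      refine (lintegral_enorm_add_sq_le hc).trans (add_le_add ?_ ?_)
      · refine mul_le_mul' le_rfl ?_
        rw [← lintegral_const_mul' _ _ (by simp)]
        exact lintegral_mono fun x ↦ enorm_smul_sq_le (h0 x) _
      · refine mul_le_mul' le_rfl ?_
        rw [← lintegral_const_mul' _ _ (by simp)]
        exact lintegral_mono fun x ↦ enorm_smul_sq_le (hb i x) _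
    calc (∫⁻ x, ‖a x • g x‖ₑ ^ 2) +
          ∑ i, ∫⁻ x, ‖fderiv ℝ (fun y ↦ a y • g y) x (stdOrthonormalBasis ℝ E i)‖ₑ ^ 2
        ≤ ENNReal.ofReal (M₀ ^ 2) * (∫⁻ x, ‖g x‖ₑ ^ 2) +
          ∑ i, (2 * (ENNReal.ofReal (M₀ ^ 2) * ∫⁻ x, ‖fderiv ℝ g x (stdOrthonormalBasis ℝ E i)‖ₑ ^ 2) +
            2 * (ENNReal.ofReal (M ^ 2) * ∫⁻ x, ‖g x‖ₑ ^ 2)) := by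
          refine add_le_add ?_ (Finset.sum_le_sum fun i _ ↦ hmain i)
          have h := sobolevEnergy_smul_le_zero h0 g
          simpa only [sobolevEnergy_zero_left] using h
      _ ≤ 2 ^ (0 + 1) * ENNReal.ofReal (M₀ ^ 2) * ((∫⁻ x, ‖g x‖ₑ ^ 2) +
            ∑ i, ∫⁻ x, ‖fderiv ℝ g x (stdOrthonormalBasis ℝ E i)‖ₑ ^ 2) +
          2 * (Module.finrank ℝ E : ℝ≥0∞) * ENNReal.ofReal (M ^ 2) * ∫⁻ x, ‖g x‖ₑ ^ 2 := by
          rw [Finset.sum_add_distrib, Finset.sum_const, Finset.card_univ, Fintype.card_fin,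
            ← Finset.mul_sum, ← Finset.mul_sum, nsmul_eq_mul]
          have hA : ENNReal.ofReal (M₀ ^ 2) * (∫⁻ x, ‖g x‖ₑ ^ 2) ≤
              2 * ENNReal.ofReal (M₀ ^ 2) * (∫⁻ x, ‖g x‖ₑ ^ 2) := by
            rw [mul_assoc]
            exact le_mul_of_one_le_left (by simp) one_le_two
          calc ENNReal.ofReal (M₀ ^ 2) * (∫⁻ x, ‖g x‖ₑ ^ 2) +
                (2 * (ENNReal.ofReal (M₀ ^ 2) * ∑ i, ∫⁻ x, ‖fderiv ℝ g x (stdOrthonormalBasis ℝ E i)‖ₑ ^ 2) +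
                  (Module.finrank ℝ E : ℝ≥0∞) * (2 * (ENNReal.ofReal (M ^ 2) * ∫⁻ x, ‖g x‖ₑ ^ 2)))
              ≤ 2 * ENNReal.ofReal (M₀ ^ 2) * (∫⁻ x, ‖g x‖ₑ ^ 2) +
                (2 * (ENNReal.ofReal (M₀ ^ 2) * ∑ i, ∫⁻ x, ‖fderiv ℝ g x (stdOrthonormalBasis ℝ E i)‖ₑ ^ 2) +
                  (Module.finrank ℝ E : ℝ≥0∞) * (2 * (ENNReal.ofReal (M ^ 2) * ∫⁻ x, ‖g x‖ₑ ^ 2))) :=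
                add_le_add hA le_rfl
            _ = _ := by ring
  | succ k ih =>
    obtain ⟨C, hCtop, hC⟩ := ih
    -- constant: `C' = 2 C + 2 n (2^{k+1} + C)`
    refine ⟨2 * C + 2 * (Module.finrank ℝ E : ℝ≥0∞) * (2 ^ (k + 1) + C), ?_, ?_⟩
    · refine ENNReal.add_ne_top.2 ⟨ENNReal.mul_ne_top (by simp) hCtop, ENNReal.mul_ne_top
        (ENNReal.mul_ne_top (by simp) (by simp)) (ENNReal.add_ne_top.2 ⟨by simp, hCtop⟩)⟩
    intro a g ha hg M₀ M h0 h1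
    have hM₀ : 0 ≤ M₀ := (abs_nonneg _).trans (h0 0)
    -- bounds for `∂ᵢ a`
    have hai : ∀ i, ContDiff ℝ ∞ fun x ↦ fderiv ℝ a x (stdOrthonormalBasis ℝ E i) := fun i ↦
      (ha.fderiv_right (m := ∞) (by norm_cast)).clm_apply contDiff_const
    have h0i : ∀ i x, |fderiv ℝ a x (stdOrthonormalBasis ℝ E i)| ≤ M := fun i x ↦ by
      have h := h1 [i] (by simp) (by simp) x
      simpa [FunctionSpaces.iterDirDeriv, Real.norm_eq_abs] using h
    have h1i : ∀ i, ∀ l : List (Fin (Module.finrank ℝ E)), l ≠ [] → l.length ≤ k + 1 →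
        ∀ x, ‖iterDirDeriv (l.map (stdOrthonormalBasis ℝ E))
          (fun y ↦ fderiv ℝ a y (stdOrthonormalBasis ℝ E i)) x‖ ≤ M := by
      intro i l hl hlen x
      have h := h1 (l ++ [i]) (by simp) (by simp; omega) x
      rwa [List.map_append, List.map_singleton, iterDirDeriv_append_singleton] at h
    have h1' : ∀ l : List (Fin (Module.finrank ℝ E)), l ≠ [] → l.length ≤ k + 1 →
        ∀ x, ‖iterDirDeriv (l.map (stdOrthonormalBasis ℝ E)) a x‖ ≤ M :=
      fun l hl hlen x ↦ h1 l hl (by omega) x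
    have hgi : ∀ i, ContDiff ℝ ∞ fun x ↦ fderiv ℝ g x (stdOrthonormalBasis ℝ E i) := fun i ↦
      (hg.fderiv_right (m := ∞) (by norm_cast)).clm_apply contDiff_const
    -- the two uses of the induction hypothesis
    have hIH1 : ∀ i, sobolevEnergy (k + 1) (fun x ↦ a x • fderiv ℝ g x (stdOrthonormalBasis ℝ E i)) ≤
        2 ^ (k + 1) * ENNReal.ofReal (M₀ ^ 2) * sobolevEnergy (k + 1)
          (fun x ↦ fderiv ℝ g x (stdOrthonormalBasis ℝ E i)) +
          C * ENNReal.ofReal (M ^ 2) * sobolevEnergy k (fun x ↦ fderiv ℝ g x (stdOrthonormalBasis ℝ E i)) :=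
      fun i ↦ hC ha (hgi i) h0 h1'
    have hIH2 : ∀ i, sobolevEnergy (k + 1) (fun x ↦ (fderiv ℝ a x (stdOrthonormalBasis ℝ E i)) • g x) ≤
        (2 ^ (k + 1) + C) * ENNReal.ofReal (M ^ 2) * sobolevEnergy (k + 1) g := fun i ↦ by
      have h := hC (hai i) hg (h0i i) (h1i i)
      refine h.trans ?_
      rw [add_mul, add_mul]
      refine add_le_add le_rfl ?_
      exact mul_le_mul' le_rfl (sobolevEnergy_le_succ k g)
    -- unfold one level and estimate
    rw [sobolevEnergy_succ (k + 1) (fun x ↦ a x • g x), sobolevEnergy_succ (k + 1) g]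
    have hmain : ∀ i, sobolevEnergy (k + 1)
        (fun x ↦ fderiv ℝ (fun y ↦ a y • g y) x (stdOrthonormalBasis ℝ E i)) ≤
        2 * (2 ^ (k + 1) * ENNReal.ofReal (M₀ ^ 2) * sobolevEnergy (k + 1)
            (fun x ↦ fderiv ℝ g x (stdOrthonormalBasis ℝ E i)) +
          C * ENNReal.ofReal (M ^ 2) * sobolevEnergy k (fun x ↦ fderiv ℝ g x (stdOrthonormalBasis ℝ E i))) +
        2 * ((2 ^ (k + 1) + C) * ENNReal.ofReal (M ^ 2) * sobolevEnergy (k + 1) g) := fun i ↦ by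
      have heq : (fun x ↦ fderiv ℝ (fun y ↦ a y • g y) x (stdOrthonormalBasis ℝ E i)) =
          fun x ↦ a x • fderiv ℝ g x (stdOrthonormalBasis ℝ E i) +
            (fderiv ℝ a x (stdOrthonormalBasis ℝ E i)) • g x :=
        funext fun x ↦ fderiv_smul_apply_eq ha hg x _
      rw [heq]
      refine (sobolevEnergy_add_le (k + 1) ((ha.smul (hgi i)).of_le (by exact_mod_cast le_top))
        (((hai i).smul hg).of_le (by exact_mod_cast le_top))).trans ?_
      exact add_le_add (mul_le_mul' le_rfl (hIH1 i)) (mul_le_mul' le_rfl (hIH2 i))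
    have hzero : (∫⁻ x, ‖a x • g x‖ₑ ^ 2) ≤ ENNReal.ofReal (M₀ ^ 2) * ∫⁻ x, ‖g x‖ₑ ^ 2 := by
      have h := sobolevEnergy_smul_le_zero h0 g
      simpa only [sobolevEnergy_zero_left] using h
    -- bookkeeping
    set A := ENNReal.ofReal (M₀ ^ 2) with hA
    set B := ENNReal.ofReal (M ^ 2) with hB
    set n : ℝ≥0∞ := (Module.finrank ℝ E : ℝ≥0∞) with hn
    set e0 := ∫⁻ x, ‖g x‖ₑ ^ 2
    set e1 := fun i ↦ sobolevEnergy (k + 1) (fun x ↦ fderiv ℝ g x (stdOrthonormalBasis ℝ E i))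
    set e2 := fun i ↦ sobolevEnergy k (fun x ↦ fderiv ℝ g x (stdOrthonormalBasis ℝ E i))
    have hsum2 : ∑ i, e2 i ≤ sobolevEnergy (k + 1) g := sum_sobolevEnergy_fderiv_le k g
    have hEk1 : sobolevEnergy (k + 1) g = e0 + ∑ i, sobolevEnergy k
        (fun x ↦ fderiv ℝ g x (stdOrthonormalBasis ℝ E i)) := sobolevEnergy_succ k g
    calc (∫⁻ x, ‖a x • g x‖ₑ ^ 2) + ∑ i, sobolevEnergy (k + 1)
          (fun x ↦ fderiv ℝ (fun y ↦ a y • g y) x (stdOrthonormalBasis ℝ E i))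
        ≤ A * e0 + ∑ i, (2 * (2 ^ (k + 1) * A * e1 i + C * B * e2 i) +
            2 * ((2 ^ (k + 1) + C) * B * sobolevEnergy (k + 1) g)) :=
          add_le_add hzero (Finset.sum_le_sum fun i _ ↦ hmain i)
      _ = A * e0 + 2 ^ (k + 1 + 1) * A * ∑ i, e1 i + 2 * C * B * ∑ i, e2 i +
            2 * n * ((2 ^ (k + 1) + C) * B * sobolevEnergy (k + 1) g) := by
          have hs : ∑ i, (2 * (2 ^ (k + 1) * A * e1 i + C * B * e2 i) +
              2 * ((2 ^ (k + 1) + C) * B * sobolevEnergy (k + 1) g)) =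
              2 * (2 ^ (k + 1) * A) * ∑ i, e1 i + 2 * (C * B) * ∑ i, e2 i +
                n * (2 * ((2 ^ (k + 1) + C) * B * sobolevEnergy (k + 1) g)) := by
            rw [Finset.sum_add_distrib, Finset.sum_const, Finset.card_univ, Fintype.card_fin,
              nsmul_eq_mul]
            congr 1
            simp only [mul_add, Finset.sum_add_distrib, ← Finset.mul_sum, mul_assoc]
          rw [hs]
          ring
      _ ≤ 2 ^ (k + 1 + 1) * A * e0 + 2 ^ (k + 1 + 1) * A * ∑ i, e1 i +
            2 * C * B * sobolevEnergy (k + 1) g +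
            2 * n * ((2 ^ (k + 1) + C) * B * sobolevEnergy (k + 1) g) := by
          refine add_le_add (add_le_add (add_le_add ?_ le_rfl) (mul_le_mul' le_rfl hsum2)) le_rfl
          refine mul_le_mul' ?_ le_rfl
          calc A = 1 * A := (one_mul A).symm
            _ ≤ 2 ^ (k + 1 + 1) * A := mul_le_mul' (one_le_pow_of_one_le' one_le_two _) le_rfl
      _ = 2 ^ (k + 1 + 1) * A * (e0 + ∑ i, e1 i) +
            (2 * C + 2 * n * (2 ^ (k + 1) + C)) * B * sobolevEnergy (k + 1) g := by ring

end Literature.Analysis.PDE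

end
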